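import Summits.QuantumFields.YangMills.Theorems.FluctuationComparisonRegPrIntLSupTailFibreOdds
import HarnessLib

/-!
# `FluctuationComparisonRegPrIntLTailSupOneFibreRows` — LINE g21-2 «DEPTH-ONE WINDOW ODDS BY A MEASURE SPLIT»: MOD₁ ∕ FAR₁-SHAPED ROWS ⟸ FIBREWISE RELATIVE BOUNDS
# (crux `UnitScaleTilt.FluctuationComparisonRegPrIntL`, stmt-QuantumFields-20520; rows MOD₁ `ModerateFieldOddsDepthOneCan`, FAR₁ `FarFieldOddsDepthOneCan` of
# `Cruxes/…/Lines/tailsup_one.lean` v1, ideator ym-r3-idea-1 g21)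

Cell `ym3-torus` (YM ladder rung R3 = continuum SU(2) Yang–Mills on T³ — a RUNG, NOT the Clay problem: not d = 4, not infinite volume, not a mass gap);
width seat `ym-ust-20520-w3` (gen 17); helper `--supports stmt-QuantumFields-20520`.  THEOREMS ONLY (0 `def`, 0 `sorry`, default heartbeats).

WHAT.  MOD₁ and FAR₁ are inequalities of the shape `(D_* (Gibbs_K|E))|W ≤ σ • (D_* (Gibbs_K|G))|W` between descended RESTRICTED Gibbs measures on the window
(`E` = a bad-field event of the fine field, `G = histGood`).  This file proves, once, the two adapters a hand needs to reach that shape from the fibre: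
* §1 (generic) ★`restrict_map_le_smul_of_setwise` — the measure inequality IS the setwise family `∀ B ⊆ W measurable, μ(D⁻¹B ∩ E) ≤ c·μ(D⁻¹B ∩ G)`
  (`Measure.le_iff`, `map_apply`, `restrict_apply`); ★★`setwise_of_fibrewise` — for a weighted finite measure `ν.withDensity w` on a standard Borel fine space, an
  a.e.-FIBREWISE relative bound `∫⁻_E w dκ_V ≤ x·∫⁻_G w dκ_V` for the conditional law `κ = condLaw ν D` at almost every window datum gives the setwise family
  (✓`…SupTailFibreOdds.withDensity_preimage_inter_eq_lintegral_condLaw` twice) — the two-event generalisation of ✓`badFraction_of_fibrewise`.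
* §2 (the runs) ★★★`gibbsK_restrict_map_le_of_fibrewise` — for the run-`K` Gibbs measure and `D = descendTo J K`: a fibrewise relative bound for the Boltzmann-weighted
  conditional Haar law ⟹ `(Measure.map D ((gibbsK K).restrict E)).restrict W_J ≤ ENNReal.ofReal σ • (Measure.map D ((gibbsK K).restrict G)).restrict W_J` — at
  `K = J + 1`, `G = histGood (J+1) J` and `E = histGoodᶜ ∩ {PlaqSmall δ₀}` resp. `{¬PlaqSmall δ₀}` this is MOD₁'s resp. FAR₁'s inequality VERBATIM, so each row
  is reduced to «on almost every fibre over the window, the weighted mass of `E` is `≤ σ` times the weighted mass of the good histories».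
HONEST SCOPE.  Disintegration bookkeeping; no large-deviation ∕ Laplace ∕ action estimate is proved; MOD₁, FAR₁, TAILSUP₁, LFR♯ᶜ, S2β, 20520, `YM3TorusSU2` NOT
proved; the Yang–Mills mass gap is NOT proved.
References: [Balaban1985Averaging] (10) p. 19; [Balaban1985UV3] (7) p. 257, (38)–(40) p. 266.
-/

noncomputable section

set_option autoImplicit false

open MeasureTheory ProbabilityTheory Filter Topology Set
open scoped ENNReal NNReal
open Literature.MathematicalPhysics.QuantumFieldTheory.Balaban1983to89
open Literature.MathematicalPhysics.QuantumFieldTheory.Balaban1983to89.T3ContinuumYM3Torus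
open Literature.MathematicalPhysics.QuantumFieldTheory.Balaban1983to89.T3NestedUnitLaws
open Literature.MathematicalPhysics.QuantumFieldTheory.Balaban1983to89.T3UnitLawDensityEML
open Literature.MathematicalPhysics.QuantumFieldTheory.Balaban1983to89.T3UnitScaleTilt
open Literature.MathematicalPhysics.QuantumFieldTheory.Balaban1983to89.T3TiltDescent
open Literature.MathematicalPhysics.QuantumFieldTheory.Balaban1983to89.Missing
open Literature.MathematicalPhysics.QuantumFieldTheory.Balaban1983to89.T4AveragingDisintegration
open Summit.QuantumFields.YangMills.Theorems.FluctuationComparisonRegPrIntLSupTailFibreOdds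
  (withDensity_preimage_inter_eq_lintegral_condLaw gibbsK_eq_smul_withDensity)

namespace Summit.QuantumFields.YangMills.Theorems.FluctuationComparisonRegPrIntLTailSupOneFibreRows

/-! ## §1 Generic: the restricted-map inequality from a setwise family; the setwise family from a fibrewise relative bound -/

section Generic

variable {α β : Type*} [MeasurableSpace α] [MeasurableSpace β]

/-- ★ **THE MEASURE ROW IS A SETWISE FAMILY**: if `μ(D⁻¹B ∩ E) ≤ c·μ(D⁻¹B ∩ G)` for every measurable `B ⊆ W` (`W` measurable, `D` measurable), then
`(D_*(μ|E))|W ≤ c • (D_*(μ|G))|W` as measures. [folklore] -/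
theorem restrict_map_le_smul_of_setwise (μ : Measure β) {D : β → α} (hD : Measurable D) {E G : Set β}
    {W : Set α} (hW : MeasurableSet W) {c : ℝ≥0∞}
    (h : ∀ B : Set α, MeasurableSet B → B ⊆ W → μ (D ⁻¹' B ∩ E) ≤ c * μ (D ⁻¹' B ∩ G)) :
    (Measure.map D (μ.restrict E)).restrict W ≤ c • (Measure.map D (μ.restrict G)).restrict W := by
  refine Measure.le_iff.mpr fun s hs => ?_
  rw [Measure.restrict_apply hs, Measure.smul_apply, Measure.restrict_apply hs, smul_eq_mul,
    Measure.map_apply hD (hs.inter hW), Measure.map_apply hD (hs.inter hW),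
    Measure.restrict_apply (hD (hs.inter hW)), Measure.restrict_apply (hD (hs.inter hW))]
  exact h (s ∩ W) (hs.inter hW) Set.inter_subset_right

variable [StandardBorelSpace β] [Nonempty β]

/-- ★★ **A FIBREWISE RELATIVE BOUND IS A SETWISE ONE** (two-event form of ✓`badFraction_of_fibrewise`): for a finite `ν`, a measurable `D`, a measurable weight `w`
and measurable fine events `E`, `G`: if for `(ν.map D)`-a.e. `V ∈ W` the `w`-weighted conditional law given `D = V` satisfies `∫⁻_E w dκ_V ≤ x·∫⁻_G w dκ_V`, then
`(ν.withDensity w)(D⁻¹B ∩ E) ≤ x·(ν.withDensity w)(D⁻¹B ∩ G)` for every measurable `B ⊆ W`. [cite: Balaban1985Averaging, (10) p.19] -/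
theorem setwise_of_fibrewise (ν : Measure β) [IsFiniteMeasure ν] {D : β → α} (hD : Measurable D) {w : β → ℝ≥0∞} (hw : Measurable w)
    {W : Set α} {E G : Set β} (hE : MeasurableSet E) (hG : MeasurableSet G) {x : ℝ≥0∞}
    (hfib : ∀ᵐ V ∂(ν.map D), V ∈ W → ∫⁻ U in E, w U ∂(condLaw ν D V) ≤ x * ∫⁻ U in G, w U ∂(condLaw ν D V)) :
    ∀ B : Set α, MeasurableSet B → B ⊆ W → (ν.withDensity w) (D ⁻¹' B ∩ E) ≤ x * (ν.withDensity w) (D ⁻¹' B ∩ G) := by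
  intro B hB hBW
  rw [withDensity_preimage_inter_eq_lintegral_condLaw ν hD hw hB hE, withDensity_preimage_inter_eq_lintegral_condLaw ν hD hw hB hG,
    ← lintegral_const_mul x (hw.setLIntegral_kernel hG)]
  exact setLIntegral_mono_ae' hB (by filter_upwards [hfib] with V hV hVB using hV (hBW hVB))

end Generic

/-! ## §2 The runs: MOD₁ ∕ FAR₁-shaped inequalities from a fibrewise relative bound for the Boltzmann-weighted conditional Haar law -/

section Runs

variable (F : T3Family) {γ : ℝ} (b₀ p₀ : ℝ) {J K : ℕ} (hJK : J ≤ K)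

/-- ★★★ **`(D_*(Gibbs_K|E))|W_J ≤ σ • (D_*(Gibbs_K|G))|W_J` ⟸ A FIBREWISE RELATIVE BOUND**: for measurable fine events `E`, `G` of run `K` and any real `σ` (`ofReal σ` enters), if for
`(dU.map D_{J,K})`-almost every window datum `V` (`PlaqSmall θ_J V`) the Boltzmann-weighted conditional Haar law of the fine field given `D_{J,K} = V` satisfies
`∫⁻_E e^{−β_K A} dκ_V ≤ σ·∫⁻_G e^{−β_K A} dκ_V`, then the descended restricted Gibbs measures obey MOD₁'s ∕ FAR₁'s inequality shape on the window.  At `K = J+1`,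
`G = histGood (J+1) J`: `E = histGoodᶜ ∩ {PlaqSmall δ₀}` gives MOD₁'s inequality VERBATIM, `E = {¬PlaqSmall δ₀}` gives FAR₁'s.
[cite: Balaban1985UV3, (7) p.257 and (38)-(40) p.266; Balaban1985Averaging, (10) p.19] -/
theorem gibbsK_restrict_map_le_of_fibrewise
    {E G : Set (GaugeField (F.P K) 0 (Matrix.specialUnitaryGroup (Fin 2) ℂ))} (hE : MeasurableSet E) (hG : MeasurableSet G) {σ : ℝ}
    (hfib : ∀ᵐ V ∂((fieldMeasure (F.P K) 0 (Matrix.specialUnitaryGroup (Fin 2) ℂ)).map (descendTo F ℰp J K hJK)),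
      PlaqSmall (θBal F.L γ b₀ p₀ J) V →
        ∫⁻ U in E, ENNReal.ofReal (boltzmann (F.P K) ((F.scheme ℰp γ).β K) U)
            ∂(condLaw (fieldMeasure (F.P K) 0 (Matrix.specialUnitaryGroup (Fin 2) ℂ)) (descendTo F ℰp J K hJK) V) ≤
          ENNReal.ofReal σ * ∫⁻ U in G, ENNReal.ofReal (boltzmann (F.P K) ((F.scheme ℰp γ).β K) U)
            ∂(condLaw (fieldMeasure (F.P K) 0 (Matrix.specialUnitaryGroup (Fin 2) ℂ)) (descendTo F ℰp J K hJK) V)) :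
    (Measure.map (descendTo F ℰp J K hJK) ((gibbsK F ℰp γ K).restrict E)).restrict
        {U : GaugeField (F.P J) 0 (Matrix.specialUnitaryGroup (Fin 2) ℂ) | PlaqSmall (θBal F.L γ b₀ p₀ J) U} ≤
      ENNReal.ofReal σ •
        (Measure.map (descendTo F ℰp J K hJK) ((gibbsK F ℰp γ K).restrict G)).restrict
          {U : GaugeField (F.P J) 0 (Matrix.specialUnitaryGroup (Fin 2) ℂ) | PlaqSmall (θBal F.L γ b₀ p₀ J) U} := by
  have hD : Measurable (descendTo F ℰp J K hJK) := measurable_descendTo F ℰp measurableE_ℰp hJK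
  have hW : MeasurableSet {U : GaugeField (F.P J) 0 (Matrix.specialUnitaryGroup (Fin 2) ℂ) | PlaqSmall (θBal F.L γ b₀ p₀ J) U} :=
    measurableSet_plaqSmall _
  have hw : Measurable fun U : GaugeField (F.P K) 0 (Matrix.specialUnitaryGroup (Fin 2) ℂ) =>
      ENNReal.ofReal (boltzmann (F.P K) ((F.scheme ℰp γ).β K) U) := (measurable_boltzmann RegularGaugeGroup.measurable_reTr _ _).ennreal_ofReal
  refine restrict_map_le_smul_of_setwise (gibbsK F ℰp γ K) hD hW fun B hB hBW => ?_
  have hset := setwise_of_fibrewise (fieldMeasure (F.P K) 0 (Matrix.specialUnitaryGroup (Fin 2) ℂ)) hD hw hE hG hfib B hB hBW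
  rw [gibbsK_eq_smul_withDensity]
  simp only [Measure.smul_apply, smul_eq_mul]
  rw [mul_left_comm]
  exact mul_le_mul' le_rfl hset

end Runs

end Summit.QuantumFields.YangMills.Theorems.FluctuationComparisonRegPrIntLTailSupOneFibreRows

end
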